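/-
Copyright (c) 2026. All rights reserved.
Released under Apache 2.0 license as described in the file LICENSE.
Authors: abc-iut cell, seat abc-iut-L5-t5 (wave 2, gen 2).
-/
import Mathlib.Analysis.Normed.Field.Basic
import Mathlib.Analysis.Normed.Group.Ultra
import Mathlib.Analysis.Normed.Module.Basic
import Mathlib.Analysis.Normed.Module.FiniteDimension
import Mathlib.Analysis.SpecialFunctions.Pow.Real
import HarnessLib

/-!
# Rescaling an ultrametric norm: the normed field `K^{(c)} = (K, ‖·‖ᶜ)`

For a field `K` with an ULTRAMETRIC norm `‖·‖` and a real exponent `c > 0`, the function `‖x‖ᶜ` is again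
an ultrametric norm on `K` (for a general norm one needs `c ≤ 1`; in the ultrametric case the strong
triangle inequality `‖x + y‖ ≤ max ‖x‖ ‖y‖` is preserved by the monotone map `t ↦ tᶜ` for every `c > 0`),
and it defines the SAME uniform structure (the balls are the same sets with re-labelled radii:
`{‖z‖ᶜ < ε} = {‖z‖ < ε^{1/c}}`). This is the elementary half of "two absolute values are equivalent iff
one is a positive power of the other" (Neukirch, *Algebraic Number Theory*, Ch. II, Prop. (3.3);
Cassels, *Local Fields*, Ch. 2, Lemma 3.2; Mathlib has the `iff` for bare `AbsoluteValue`s as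
`AbsoluteValue.isEquiv_iff_exists_rpow_eq`, but no normed-field packaging of the power).

We package it as a TYPE SYNONYM `NormRescale K c` (definitionally `K`, same `Field` structure, same
uniform structure) carrying

* `NormedField (NormRescale K c)` with `‖x‖ = ‖x‖_K ^ c` (`norm_def`), `NontriviallyNormedField` when `K`
  is, `IsUltrametricDist`;
* `CompleteSpace` / `LocallyCompactSpace` / `ProperSpace` inherited from `K` (same uniformity);
* `NormRescale.normedAlgebra`: if `K` is an algebra over a normed field `𝕜` and
  `‖algebraMap 𝕜 K r‖ ^ c = ‖r‖` for all `r`, then `NormRescale K c` is a NORMED `𝕜`-algebra (a `def`,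
  installed with `letI`, since it depends on that hypothesis).

MOTIVATION (cell abc-iut): Mathlib's norm on the completion `K_v = v.adicCompletion F` of a number field
at a finite place `v ∣ p` restricts to `|·|_p ^ {n_v}` on `ℚ_p` (`n_v = [K_v:ℚ_p]`), so `K_v` is NOT a normed
`ℚ_p`-algebra in Mathlib's sense when `n_v > 1` (`‖p‖_v = p^{-n_v} ≠ p^{-1}`), while the `p`-adic-logarithm
files of the cell (`Literature.IUT.LogVolume.LocalUnitLog`, …) are written for normed `ℚ_p`-algebras.
`NormRescale K_v (1/n_v)` IS one, with the same elements, field operations, topology, unit ball and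
principal units, so every norm-free conclusion transfers verbatim. Nothing below is specific to that use.

## References
* J. Neukirch, *Algebraic Number Theory*, Grundlehren 322 (1999), Ch. II §3, Prop. (3.3) and §4
  [NeukirchANT1999].
* J. W. S. Cassels, *Local Fields*, LMS Student Texts 3 (1986), Ch. 2, Lemma 3.2.
-/

noncomputable section

open Filter Metric Set
open scoped Topology Uniformity

/-- The type synonym `K^{(c)}`: the same type `K`, to be equipped with the rescaled norm `‖x‖ ^ c`.
[cite: NeukirchANT1999, Ch. II Prop. (3.3)] -/
@[nolint unusedArguments]
def NormRescale (K : Type*) (_c : ℝ) : Type _ := K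

namespace NormRescale

/-! ## Algebraic structure: everything is inherited from `K` unchanged -/

/-- The identification `K^{(c)} ≃ K` (the identity map). [cite: NeukirchANT1999, Ch. II Prop. (3.3)] -/
def equiv (K : Type*) (c : ℝ) : NormRescale K c ≃ K := Equiv.refl _

/-- `K^{(c)}` is the field `K`. [folklore] -/
instance instField {K : Type*} [Field K] {c : ℝ} : Field (NormRescale K c) := inferInstanceAs (Field K)

/-- `K^{(c)}` is inhabited (by `0`). [folklore] -/
instance instInhabited {K : Type*} [Field K] {c : ℝ} : Inhabited (NormRescale K c) := ⟨0⟩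

/-- `K^{(c)}` has the characteristic of `K`. [folklore] -/
instance instCharZero {K : Type*} [Field K] [CharZero K] {c : ℝ} : CharZero (NormRescale K c) :=
  inferInstanceAs (CharZero K)

/-- The identification `K^{(c)} ≃+* K` as a ring isomorphism (the identity).
[cite: NeukirchANT1999, Ch. II Prop. (3.3)] -/
def ringEquiv (K : Type*) [Field K] (c : ℝ) : NormRescale K c ≃+* K := RingEquiv.refl _

/-- `ringEquiv` is `equiv` on elements (plumbing). [folklore] -/
@[simp] private theorem ringEquiv_apply {K : Type*} [Field K] {c : ℝ} (x : NormRescale K c) :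
    ringEquiv K c x = equiv K c x := rfl

/-- `equiv⁻¹ ∘ equiv = id` (plumbing). [folklore] -/
@[simp] private theorem equiv_symm_apply_equiv {K : Type*} {c : ℝ} (x : NormRescale K c) :
    (equiv K c).symm (equiv K c x) = x := rfl

/-- `equiv ∘ equiv⁻¹ = id` (plumbing). [folklore] -/
@[simp] private theorem equiv_apply_equiv_symm {K : Type*} {c : ℝ} (x : K) :
    equiv K c ((equiv K c).symm x) = x := rfl

/-- `equiv` is additive (it is the identity; plumbing). [folklore] -/
private theorem equiv_add {K : Type*} [Field K] {c : ℝ} (x y : NormRescale K c) :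
    equiv K c (x + y) = equiv K c x + equiv K c y := rfl

/-- `equiv` is multiplicative (plumbing). [folklore] -/
private theorem equiv_mul {K : Type*} [Field K] {c : ℝ} (x y : NormRescale K c) :
    equiv K c (x * y) = equiv K c x * equiv K c y := rfl

/-- `equiv` respects subtraction (plumbing). [folklore] -/
private theorem equiv_sub {K : Type*} [Field K] {c : ℝ} (x y : NormRescale K c) :
    equiv K c (x - y) = equiv K c x - equiv K c y := rfl

/-- `equiv` respects negation (plumbing). [folklore] -/
private theorem equiv_neg {K : Type*} [Field K] {c : ℝ} (x : NormRescale K c) :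
    equiv K c (-x) = -equiv K c x := rfl

/-- `equiv 1 = 1` (plumbing). [folklore] -/
private theorem equiv_one {K : Type*} [Field K] {c : ℝ} : equiv K c (1 : NormRescale K c) = 1 := rfl

/-- `equiv 0 = 0` (plumbing). [folklore] -/
private theorem equiv_zero {K : Type*} [Field K] {c : ℝ} : equiv K c (0 : NormRescale K c) = 0 := rfl

/-- `equiv` respects powers (plumbing). [folklore] -/
private theorem equiv_pow {K : Type*} [Field K] {c : ℝ} (x : NormRescale K c) (n : ℕ) :
    equiv K c (x ^ n) = equiv K c x ^ n := rfl

/-- `equiv` respects inverses (plumbing). [folklore] -/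
private theorem equiv_inv {K : Type*} [Field K] {c : ℝ} (x : NormRescale K c) :
    equiv K c x⁻¹ = (equiv K c x)⁻¹ := rfl

/-- `equiv` fixes numerals (plumbing). [folklore] -/
private theorem equiv_natCast {K : Type*} [Field K] {c : ℝ} (n : ℕ) :
    equiv K c (n : NormRescale K c) = n := rfl

/-- `K^{(c)}` is an algebra over whatever `K` is an algebra over (same structure map).
[cite: NeukirchANT1999, Ch. II Prop. (3.3)] -/
instance instAlgebra {𝕜 : Type*} [CommSemiring 𝕜] {K : Type*} [Field K] [Algebra 𝕜 K] {c : ℝ} :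
    Algebra 𝕜 (NormRescale K c) :=
  inferInstanceAs (Algebra 𝕜 K)

/-- The structure map of `K^{(c)}` is that of `K`: `equiv (algebraMap 𝕜 K^{(c)} r) = algebraMap 𝕜 K r`.
[cite: NeukirchANT1999, Ch. II Prop. (3.3)] -/
theorem equiv_algebraMap {𝕜 : Type*} [CommSemiring 𝕜] {K : Type*} [Field K] [Algebra 𝕜 K] {c : ℝ}
    (r : 𝕜) : equiv K c (algebraMap 𝕜 (NormRescale K c) r) = algebraMap 𝕜 K r := rfl

/-! ## The rescaled norm -/

section Normed

variable {K : Type*} [NormedField K] {c : ℝ}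

/-- The rescaled norm function `x ↦ ‖x‖_K ^ c` (it becomes `‖·‖` of `K^{(c)}` below).
[cite: NeukirchANT1999, Ch. II Prop. (3.3)] -/
def rnorm (x : NormRescale K c) : ℝ := ‖equiv K c x‖ ^ c

/-- `‖x‖ ^ c ≥ 0` (plumbing). [folklore] -/
private theorem rnorm_nonneg (x : NormRescale K c) : 0 ≤ rnorm x := Real.rpow_nonneg (norm_nonneg _) _

/-- `‖xy‖ ^ c = ‖x‖ ^ c · ‖y‖ ^ c` (plumbing for the `NormedField` structure). [folklore] -/
private theorem rnorm_mul (x y : NormRescale K c) : rnorm (x * y) = rnorm x * rnorm y := by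
  unfold rnorm
  rw [equiv_mul, norm_mul, Real.mul_rpow (norm_nonneg _) (norm_nonneg _)]

/-- `‖-x‖ ^ c = ‖x‖ ^ c` (plumbing). [folklore] -/
private theorem rnorm_neg (x : NormRescale K c) : rnorm (-x) = rnorm x := by
  unfold rnorm
  rw [equiv_neg, norm_neg]

/-- `‖0‖ ^ c = 0` for `c ≠ 0` (plumbing). [folklore] -/
private theorem rnorm_zero (hc : c ≠ 0) : rnorm (0 : NormRescale K c) = 0 := by
  unfold rnorm
  rw [equiv_zero, norm_zero, Real.zero_rpow hc]

/-- `‖x‖ ^ c = 0 ↔ x = 0` for `c ≠ 0` (plumbing). [folklore] -/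
private theorem rnorm_eq_zero_iff (hc : c ≠ 0) (x : NormRescale K c) : rnorm x = 0 ↔ x = 0 := by
  unfold rnorm
  rw [Real.rpow_eq_zero_iff_of_nonneg (norm_nonneg _), norm_eq_zero]
  exact ⟨fun h => h.1, fun h => ⟨h, hc⟩⟩

/-- `(max a b) ^ c ≤ max (a ^ c) (b ^ c)` (plumbing; in fact an equality). [folklore] -/
private theorem max_rpow_le (a b : ℝ) : (max a b) ^ c ≤ max (a ^ c) (b ^ c) := by
  rcases le_total a b with h | h
  · rw [max_eq_right h]; exact le_max_right _ _
  · rw [max_eq_left h]; exact le_max_left _ _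

/-- The strong triangle inequality survives rescaling by any `c ≥ 0` (monotonicity of `t ↦ t ^ c`).
[cite: NeukirchANT1999, Ch. II Prop. (3.3)] -/
theorem rnorm_add_le_max [IsUltrametricDist K] (hc : 0 ≤ c) (x y : NormRescale K c) :
    rnorm (x + y) ≤ max (rnorm x) (rnorm y) := by
  unfold rnorm
  refine le_trans ?_ (max_rpow_le _ _)
  rw [equiv_add]
  exact Real.rpow_le_rpow (norm_nonneg _) (IsUltrametricDist.norm_add_le_max _ _) hc

/-- The basic radius comparison: `t ^ c < ε ↔ t < ε ^ {1/c}` (`t ≥ 0`, `ε > 0`, `c > 0`; plumbing). [folklore] -/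
private theorem rpow_lt_iff_lt_rpow_inv (hc : 0 < c) {t ε : ℝ} (ht : 0 ≤ t) (hε : 0 < ε) :
    t ^ c < ε ↔ t < ε ^ c⁻¹ := by
  constructor
  · intro h
    have := Real.rpow_lt_rpow (Real.rpow_nonneg ht c) h (inv_pos.mpr hc)
    rwa [← Real.rpow_mul ht, mul_inv_cancel₀ hc.ne', Real.rpow_one] at this
  · intro h
    have := Real.rpow_lt_rpow ht h hc
    rwa [← Real.rpow_mul hε.le, inv_mul_cancel₀ hc.ne', Real.rpow_one] at this

variable [IsUltrametricDist K] [hc : Fact (0 < c)]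

/-- **`K^{(c)}` is a normed field** with norm `‖x‖_K ^ c`, and with the uniform structure OF `K`
(Neukirch ANT II (3.3): `|·|ᶜ` is an equivalent absolute value; ultrametricity allows every `c > 0`).
[cite: NeukirchANT1999, Ch. II Prop. (3.3)] -/
instance instNormedField : NormedField (NormRescale K c) :=
  { (inferInstance : Field (NormRescale K c)) with
    norm := rnorm
    dist := fun x y => rnorm (-x + y)
    dist_self := fun x => by
      show rnorm (-x + x) = 0
      rw [neg_add_cancel, rnorm_zero hc.out.ne']
    dist_comm := fun x y => by
      show rnorm (-x + y) = rnorm (-y + x)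
      rw [← rnorm_neg, neg_add_rev, neg_neg]
    dist_triangle := fun x y z => by
      show rnorm (-x + z) ≤ rnorm (-x + y) + rnorm (-y + z)
      have h : -x + z = (-x + y) + (-y + z) := by abel
      rw [h]
      exact (rnorm_add_le_max hc.out.le _ _).trans
        (max_le_add_of_nonneg (rnorm_nonneg _) (rnorm_nonneg _))
    eq_of_dist_eq_zero := fun {x y} h => by
      change rnorm (-x + y) = 0 at h
      exact neg_add_eq_zero.mp ((rnorm_eq_zero_iff hc.out.ne' _).mp h)
    dist_eq := fun _ _ => rfl
    norm_mul := rnorm_mul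
    toUniformSpace := (inferInstance : UniformSpace K)
    uniformity_dist := by
      have hc0 : 0 < c := hc.out
      change 𝓤 K = _
      rw [PseudoMetricSpace.uniformity_dist]
      apply le_antisymm
      · refine le_iInf₂ fun ε hε => iInf₂_le_of_le (ε ^ c⁻¹) (Real.rpow_pos_of_pos hε _) ?_
        refine principal_mono.mpr fun p (hp : dist p.1 p.2 < ε ^ c⁻¹) => ?_
        change ‖-(equiv K c p.1) + equiv K c p.2‖ ^ c < ε
        rwa [rpow_lt_iff_lt_rpow_inv hc0 (norm_nonneg _) hε, ← dist_eq_norm_neg_add]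
      · refine le_iInf₂ fun δ hδ => iInf₂_le_of_le (δ ^ c) (Real.rpow_pos_of_pos hδ _) ?_
        refine principal_mono.mpr fun p (hp : ‖-(equiv K c p.1) + equiv K c p.2‖ ^ c < δ ^ c) => ?_
        change dist (equiv K c p.1) (equiv K c p.2) < δ
        rw [dist_eq_norm_neg_add]
        exact (Real.rpow_lt_rpow_iff (norm_nonneg _) hδ.le hc0).mp hp }

/-- The norm of `K^{(c)}` is `‖x‖_K ^ c`. [cite: NeukirchANT1999, Ch. II Prop. (3.3)] -/
theorem norm_def (x : NormRescale K c) : ‖x‖ = ‖equiv K c x‖ ^ c := rfl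

/-- The norm of `K^{(c)}` on an element coming from `K`. [cite: NeukirchANT1999, Ch. II Prop. (3.3)] -/
theorem norm_equiv_symm (x : K) : ‖(equiv K c).symm x‖ = ‖x‖ ^ c := rfl

/-- The uniform structure of `K^{(c)}` IS that of `K` (definitionally). [cite: NeukirchANT1999, Ch. II Prop. (3.3)] -/
theorem uniformSpace_eq :
    (inferInstance : UniformSpace (NormRescale K c)) = (inferInstance : UniformSpace K) := rfl

/-- The identity `K^{(c)} → K` is uniformly continuous (same uniformity). [cite: NeukirchANT1999, Ch. II Prop. (3.3)] -/
theorem uniformContinuous_equiv : UniformContinuous (equiv K c) := uniformContinuous_id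

/-- The identity `K → K^{(c)}` is uniformly continuous (same uniformity). [cite: NeukirchANT1999, Ch. II Prop. (3.3)] -/
theorem uniformContinuous_equiv_symm : UniformContinuous (equiv K c).symm := uniformContinuous_id

/-- The identity `K^{(c)} → K` is continuous (same topology). [cite: NeukirchANT1999, Ch. II Prop. (3.3)] -/
theorem continuous_equiv : Continuous (equiv K c) := continuous_id

/-- The identity `K → K^{(c)}` is continuous (same topology). [cite: NeukirchANT1999, Ch. II Prop. (3.3)] -/
theorem continuous_equiv_symm : Continuous (equiv K c).symm := continuous_id

/-- `K^{(c)} ≃ₜ K` (the identity as a homeomorphism). [cite: NeukirchANT1999, Ch. II Prop. (3.3)] -/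
def homeomorph (K : Type*) [NormedField K] [IsUltrametricDist K] (c : ℝ) [Fact (0 < c)] :
    NormRescale K c ≃ₜ K where
  toEquiv := equiv K c
  continuous_toFun := continuous_equiv
  continuous_invFun := continuous_equiv_symm

/-- `K^{(c)}` is ultrametric. [cite: NeukirchANT1999, Ch. II Prop. (3.3)] -/
instance instIsUltrametricDist : IsUltrametricDist (NormRescale K c) :=
  IsUltrametricDist.isUltrametricDist_of_forall_norm_add_le_max_norm
    fun x y => rnorm_add_le_max hc.out.le x y

/-- `K^{(c)}` is complete when `K` is (same uniformity). [cite: NeukirchANT1999, Ch. II Prop. (3.3)] -/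
instance instCompleteSpace [CompleteSpace K] : CompleteSpace (NormRescale K c) :=
  inferInstanceAs (CompleteSpace K)

/-- `K^{(c)}` is locally compact when `K` is (same topology). [cite: NeukirchANT1999, Ch. II Prop. (3.3)] -/
instance instLocallyCompactSpace [LocallyCompactSpace K] : LocallyCompactSpace (NormRescale K c) :=
  inferInstanceAs (LocallyCompactSpace K)

/-- `‖x‖_{(c)} ≤ 1 ↔ ‖x‖_K ≤ 1`: the closed unit ball (the valuation ring) is unchanged.
[cite: NeukirchANT1999, Ch. II Prop. (3.3)] -/
theorem norm_le_one_iff (x : NormRescale K c) : ‖x‖ ≤ 1 ↔ ‖equiv K c x‖ ≤ 1 := by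
  rw [norm_def, ← Real.one_rpow c, Real.rpow_le_rpow_iff (norm_nonneg _) zero_le_one hc.out,
    Real.one_rpow]

/-- `‖x‖_{(c)} < 1 ↔ ‖x‖_K < 1`: the open unit ball (the maximal ideal) is unchanged.
[cite: NeukirchANT1999, Ch. II Prop. (3.3)] -/
theorem norm_lt_one_iff (x : NormRescale K c) : ‖x‖ < 1 ↔ ‖equiv K c x‖ < 1 := by
  rw [norm_def, ← Real.one_rpow c, Real.rpow_lt_rpow_iff (norm_nonneg _) zero_le_one hc.out,
    Real.one_rpow]

/-- `1 ≤ ‖x‖_{(c)} ↔ 1 ≤ ‖x‖_K`. [cite: NeukirchANT1999, Ch. II Prop. (3.3)] -/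
theorem one_le_norm_iff (x : NormRescale K c) : 1 ≤ ‖x‖ ↔ 1 ≤ ‖equiv K c x‖ := by
  rw [← not_lt, norm_lt_one_iff, not_lt]

/-- `1 < ‖x‖_{(c)} ↔ 1 < ‖x‖_K`. [cite: NeukirchANT1999, Ch. II Prop. (3.3)] -/
theorem one_lt_norm_iff (x : NormRescale K c) : 1 < ‖x‖ ↔ 1 < ‖equiv K c x‖ := by
  rw [← not_le, norm_le_one_iff, not_le]

/-- `‖x‖_{(c)} = 1 ↔ ‖x‖_K = 1`: the unit sphere (the unit group of the valuation ring) is unchanged.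
[cite: NeukirchANT1999, Ch. II Prop. (3.3)] -/
theorem norm_eq_one_iff (x : NormRescale K c) : ‖x‖ = 1 ↔ ‖equiv K c x‖ = 1 := by
  rw [le_antisymm_iff, le_antisymm_iff, norm_le_one_iff, one_le_norm_iff]

/-- General radius comparison: `‖x‖_{(c)} < r ↔ ‖x‖_K < r ^ {1/c}` for `r > 0`.
[cite: NeukirchANT1999, Ch. II Prop. (3.3)] -/
theorem norm_lt_iff (x : NormRescale K c) {r : ℝ} (hr : 0 < r) : ‖x‖ < r ↔ ‖equiv K c x‖ < r ^ c⁻¹ :=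
  rpow_lt_iff_lt_rpow_inv hc.out (norm_nonneg _) hr

/-- General radius comparison: `‖x‖_{(c)} ≤ r ↔ ‖x‖_K ≤ r ^ {1/c}` for `r ≥ 0`.
[cite: NeukirchANT1999, Ch. II Prop. (3.3)] -/
theorem norm_le_iff (x : NormRescale K c) {r : ℝ} (hr : 0 ≤ r) : ‖x‖ ≤ r ↔ ‖equiv K c x‖ ≤ r ^ c⁻¹ := by
  have hc0 : 0 < c := hc.out
  rw [norm_def]
  conv_lhs => rw [show r = (r ^ c⁻¹) ^ c by
    rw [← Real.rpow_mul hr, inv_mul_cancel₀ hc0.ne', Real.rpow_one]]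
  exact Real.rpow_le_rpow_iff (norm_nonneg _) (Real.rpow_nonneg hr _) hc0

/-- `‖x‖_{(c)} = s ^ c` when `‖x‖_K = s`. [cite: NeukirchANT1999, Ch. II Prop. (3.3)] -/
theorem norm_eq_rpow_of_eq {x : NormRescale K c} {s : ℝ} (h : ‖equiv K c x‖ = s) : ‖x‖ = s ^ c := by
  rw [norm_def, h]

end Normed

/-! ## Nontriviality, properness, normed-algebra structure -/

/-- `K^{(c)}` is nontrivially normed when `K` is. [cite: NeukirchANT1999, Ch. II Prop. (3.3)] -/
instance instNontriviallyNormedField {K : Type*} [NontriviallyNormedField K] [IsUltrametricDist K]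
    {c : ℝ} [Fact (0 < c)] : NontriviallyNormedField (NormRescale K c) where
  non_trivial := by
    obtain ⟨x, hx⟩ := NormedField.exists_one_lt_norm K
    exact ⟨(equiv K c).symm x, (one_lt_norm_iff ((equiv K c).symm x)).mpr hx⟩

/-- `K^{(c)}` is a proper metric space when `K` is a locally compact nontrivially normed field
(Mathlib `ProperSpace.of_locallyCompactSpace`). [cite: NeukirchANT1999, Ch. II Prop. (3.3)] -/
instance instProperSpace {K : Type*} [NontriviallyNormedField K] [IsUltrametricDist K]
    [LocallyCompactSpace K] {c : ℝ} [Fact (0 < c)] : ProperSpace (NormRescale K c) :=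
  ProperSpace.of_locallyCompactSpace (NormRescale K c)

/-- **Normed-algebra structure after rescaling.** If `K` is an algebra over a normed field `𝕜` whose
structure map satisfies `‖algebraMap 𝕜 K r‖_K ^ c = ‖r‖_𝕜` (i.e. `‖·‖_K` restricts to `‖·‖_𝕜 ^ {1/c}`),
then `K^{(c)}` is a normed `𝕜`-algebra. A `def` (it depends on the hypothesis); install with `letI`.
[cite: NeukirchANT1999, Ch. II Prop. (3.3)] -/
@[reducible] def normedAlgebra {K : Type*} [NormedField K] [IsUltrametricDist K] {c : ℝ} [Fact (0 < c)]
    (𝕜 : Type*) [NormedField 𝕜] [Algebra 𝕜 K]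
    (h : ∀ r : 𝕜, ‖algebraMap 𝕜 K r‖ ^ c = ‖r‖) : NormedAlgebra 𝕜 (NormRescale K c) :=
  { (instAlgebra : Algebra 𝕜 (NormRescale K c)) with
    norm_smul_le := fun r x => by
      rw [Algebra.smul_def, norm_mul, norm_def (algebraMap 𝕜 (NormRescale K c) r), equiv_algebraMap, h r] }

end NormRescale
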